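/-
Copyright: harness tree, Literature layer (sorry-free). b2b-lace enum2-g12 (ENUMERATION SHARD B gen 12),
GAPS G8 (δ2)(i), SEEDCERT_U M1 (L3 + the `[0,T] / [T,∞)` split of the Bessel `u`-representation).
-/
import Literature.Probability.FitznerVanDerHofstad2017.SrwIntegralBesselU
import Mathlib.Analysis.SpecialFunctions.ExpDeriv
import Mathlib.MeasureTheory.Integral.IntervalIntegral.FundThmCalculus
import HarnessLib

/-!
# The `[0,T] / [T,∞)` split of the Bessel `u`-representation; the `[0,T]` block as a Poisson-tail series

Fitzner–van der Hofstad [NoBLE17, §5.1.1 (5.4)–(5.5)] evaluate the SRW integrals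
`I_{n,0}(x;d)` from the Bessel representation by splitting the `t`-integral at a cut-off `T`:
on `[0,T]` the integrand is integrated term-wise / numerically, on `[T,∞)` the large-argument
asymptotics of the modified Bessel function is used.  This file supplies the KERNEL identities
behind the first half, on top of `SrwIntegralBesselU`
(`srwI d (n+1) 0 x = d^{n+1}/n! · ∫_{u>0} uⁿ ∏_μ q_u(x_μ) du`, `q_u(m) = e^{-u} I_m(u)`):

* `poissonTail λ k = 1 - e^{-λ} Σ_{i<k} λ^i/i!` (`= ℙ[Poisson(λ) ≥ k]`, the regularised lower
  incomplete Gamma function `P(k,λ)` at integer parameter), with `poissonTail_nonneg`,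
  `poissonTail_le_one`, `poissonTail_succ` and the tail bound
  `poissonTail_le_pow_div_factorial : poissonTail λ k ≤ λ^k/k!`;
* `integral_pow_mul_exp_neg_mul_Ioc` — the truncated Gamma integral
  `∫_{0<u≤T} uᵏ e^{-ru} du = k!/r^{k+1} · poissonTail (rT) (k+1)` (fundamental theorem of calculus
  with the closed-form antiderivative `-(k!/r^{k+1}) e^{-ru} Σ_{i≤k} (ru)^i/i!`);
* `hasSum_choose_mul_srwLaw_mul_poissonTail` — for `d ≥ 2n+3`, `T ≥ 0`, the `[0,T]` BLOCK IS A
  POISSON-TAIL SERIES: `Σ_m C(m+n,n) p_m(x;d) · poissonTail (dT) (m+n+1)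
  = d^{n+1}/n! · ∫_{0<u≤T} uⁿ ∏_μ q_u(x_μ) du` (term-wise integration of the Poissonised series of
  `SrwLawBesselEGF.hasSum_srwLaw_poisson`; all terms nonnegative) — the kernel form of the
  elementary identity `(dⁿ/(n-1)!) ∫₀ᵀ u^{n-1} e^{-du} (du)^k/k! du = C(k+n-1,n-1) · Q(k+n, dT)`
  used by the SEEDCERT-U certificate (its L3), and the complementary
  `hasSum_choose_mul_srwLaw_mul_one_sub_poissonTail` for the `[T,∞)` block;
* `srwI_succ_zero_eq_integral_Ioc_add_integral_Ioi` — the SPLIT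
  `srwI d (n+1) 0 x = d^{n+1}/n! · ∫_{0<u≤T} uⁿ∏_μ q_u(x_μ) du + d^{n+1}/n! · ∫_{u>T} uⁿ∏_μ q_u(x_μ) du`
  (obtained by adding the two series — no integrability of the full integrand is needed);
* `sum_choose_mul_srwLaw_mul_poissonTail_le` — every partial sum of the Poisson-tail series is a
  lower bound of the `[0,T]` block; `integral_Ioc_le_sum_add_tail` — the `[0,T]` block exceeds
  the `M`-th partial sum by at most the `M`-tail `Σ_{m≥M} C(m+n,n) p_m` of the plain series
  (`poissonTail ≤ 1`); `integral_Ioc_le_sum_add_of_hasSum` — … and by at most any bound of the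
  `p`-free majorant `Σ_{m≥M} C(m+n,n) ℙ[Poisson(dT) ≥ m+n+1]` (`p_m ≤ 1`), which decays
  super-exponentially once `M ≫ dT` (`poissonTail_le_pow_div_factorial`), so that an evaluator
  needs rational brackets of `e^{-dT}` and of finitely many `p_m(x;d)` only; the `[T,∞)` block is
  where the large-`u` brackets of `q_u` enter (SEEDCERT_U M2, not here).

No tables, no `d = 11`-specific content; record files untouched.

References: R. Fitzner, R. van der Hofstad, *Mean-field behavior for nearest-neighbor percolation
in `d > 10`*, Electron. J. Probab. 22 (2017), §5.1.1 (5.2)–(5.5), pp. 1089–1090 (published form of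
[NoBLE17] = arXiv:1506.07969). [cite: FitznerVanDerHofstad2016NoBLE, §5.1.1 (5.4)-(5.5) p. 1090];
T. Hara, G. Slade, *The lace expansion for self-avoiding walk in five or more dimensions*,
Rev. Math. Phys. 4 (1992), Appendix B (numerical evaluation of the SRW Bessel integrals by
splitting at a cut-off). [cite: HaraSlade1992b, Appendix B]
-/


noncomputable section

open Finset Real MeasureTheory Set
open scoped Nat

namespace Literature.Probability.FitznerVanDerHofstad2017

open Literature.Barriers.CriticalPhenomena.LongRangePhi4 (srwLaw srwLaw_nonneg srwLaw_le_one)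
open Literature.Probability.LatticeModels (srwHeatKernel)

variable {d : ℕ}

/-! ## The Poisson tail `ℙ[Poisson(λ) ≥ k]` -/

/-- The partial exponential sum `Σ_{i<k} λ^i / i!`. [folklore] -/
def expPartial (lam : ℝ) (k : ℕ) : ℝ := ∑ i ∈ range k, lam ^ i / (i ! : ℝ)

/-- The Poisson tail `poissonTail λ k = 1 - e^{-λ} Σ_{i<k} λ^i/i! = ℙ[Poisson(λ) ≥ k]`
(`= P(k,λ)`, the regularised lower incomplete Gamma function at the integer `k ≥ 1`). [folklore] -/
def poissonTail (lam : ℝ) (k : ℕ) : ℝ := 1 - Real.exp (-lam) * expPartial lam k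

/-- `Σ_{i<k+1} λ^i/i! = Σ_{i<k} λ^i/i! + λ^k/k!`. [folklore] -/
theorem expPartial_succ (lam : ℝ) (k : ℕ) :
    expPartial lam (k + 1) = expPartial lam k + lam ^ k / (k ! : ℝ) := by
  simp [expPartial, sum_range_succ]

/-- The empty partial sum. [folklore] -/
theorem expPartial_zero_right (lam : ℝ) : expPartial lam 0 = 0 := by simp [expPartial]

/-- `Σ_{i<k+1} 0^i/i! = 1`. [folklore] -/
theorem expPartial_zero_left_succ (k : ℕ) : expPartial 0 (k + 1) = 1 := by
  induction k with
  | zero => simp [expPartial]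
  | succ k ih => rw [expPartial_succ, ih, zero_pow (Nat.succ_ne_zero k), zero_div, add_zero]

/-- `0 ≤ Σ_{i<k} λ^i/i!` for `λ ≥ 0`. [folklore] -/
theorem expPartial_nonneg {lam : ℝ} (hlam : 0 ≤ lam) (k : ℕ) : 0 ≤ expPartial lam k :=
  sum_nonneg fun i _ => by positivity

/-- `Σ_{i<k} λ^i/i! ≤ e^λ` for `λ ≥ 0`. [folklore] -/
theorem expPartial_le_exp {lam : ℝ} (hlam : 0 ≤ lam) (k : ℕ) : expPartial lam k ≤ Real.exp lam :=
  Real.sum_le_exp_of_nonneg hlam k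

/-- `ℙ[Poisson(λ) ≥ 0] = 1`. [folklore] -/
theorem poissonTail_zero_right (lam : ℝ) : poissonTail lam 0 = 1 := by
  simp [poissonTail, expPartial_zero_right]

/-- `ℙ[Poisson(λ) ≥ k+1] = ℙ[Poisson(λ) ≥ k] - e^{-λ} λ^k/k!`. [folklore] -/
theorem poissonTail_succ (lam : ℝ) (k : ℕ) :
    poissonTail lam (k + 1) = poissonTail lam k - Real.exp (-lam) * (lam ^ k / (k ! : ℝ)) := by
  simp only [poissonTail, expPartial_succ]; ring

/-- `0 ≤ ℙ[Poisson(λ) ≥ k]` for `λ ≥ 0`. [folklore] -/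
theorem poissonTail_nonneg {lam : ℝ} (hlam : 0 ≤ lam) (k : ℕ) : 0 ≤ poissonTail lam k := by
  have h := expPartial_le_exp hlam k
  have hmul : Real.exp (-lam) * expPartial lam k ≤ Real.exp (-lam) * Real.exp lam :=
    mul_le_mul_of_nonneg_left h (Real.exp_pos _).le
  rw [← Real.exp_add, neg_add_cancel, Real.exp_zero] at hmul
  unfold poissonTail; linarith

/-- `ℙ[Poisson(λ) ≥ k] ≤ 1` for `λ ≥ 0`. [folklore] -/
theorem poissonTail_le_one {lam : ℝ} (hlam : 0 ≤ lam) (k : ℕ) : poissonTail lam k ≤ 1 := by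
  have : 0 ≤ Real.exp (-lam) * expPartial lam k :=
    mul_nonneg (Real.exp_pos _).le (expPartial_nonneg hlam k)
  unfold poissonTail; linarith

/-- The real exponential series `Σ_i λ^i/i! = e^λ`. [folklore] -/
theorem hasSum_pow_div_factorial_exp (lam : ℝ) :
    HasSum (fun i : ℕ => lam ^ i / (i ! : ℝ)) (Real.exp lam) := by
  rw [Real.exp_eq_exp_ℝ]
  exact NormedSpace.expSeries_div_hasSum_exp lam

/-- **Chernoff-free tail bound** `ℙ[Poisson(λ) ≥ k] ≤ λ^k / k!` (`λ ≥ 0`; from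
`Σ_{i≥k} λ^i/i! ≤ (λ^k/k!) e^λ`, i.e. `k! j! ≤ (k+j)!`). [folklore] -/
theorem poissonTail_le_pow_div_factorial {lam : ℝ} (hlam : 0 ≤ lam) (k : ℕ) :
    poissonTail lam k ≤ lam ^ k / (k ! : ℝ) := by
  have hE := hasSum_pow_div_factorial_exp lam
  have htail : HasSum (fun j : ℕ => lam ^ (j + k) / ((j + k)! : ℝ))
      (Real.exp lam - expPartial lam k) := (hasSum_nat_add_iff' k).mpr hE
  have hle : ∀ j : ℕ, lam ^ (j + k) / ((j + k)! : ℝ) ≤ lam ^ k / (k ! : ℝ) * (lam ^ j / (j ! : ℝ)) := by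
    intro j
    rw [div_mul_div_comm, ← pow_add, add_comm j k]
    have hkj : ((k ! : ℕ) : ℝ) * ((j ! : ℕ) : ℝ) ≤ (((k + j)! : ℕ) : ℝ) := by
      exact_mod_cast Nat.le_of_dvd (Nat.factorial_pos _)
        (Nat.factorial_mul_factorial_dvd_factorial_add k j)
    exact div_le_div_of_nonneg_left (pow_nonneg hlam _) (by positivity) hkj
  have hmaj : HasSum (fun j : ℕ => lam ^ k / (k ! : ℝ) * (lam ^ j / (j ! : ℝ)))
      (lam ^ k / (k ! : ℝ) * Real.exp lam) := hE.mul_left _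
  have h := hasSum_le hle htail hmaj
  have hpos : 0 < Real.exp (-lam) := Real.exp_pos _
  have hee : Real.exp (-lam) * Real.exp lam = 1 := by
    rw [← Real.exp_add, neg_add_cancel, Real.exp_zero]
  unfold poissonTail
  calc 1 - Real.exp (-lam) * expPartial lam k
      = Real.exp (-lam) * (Real.exp lam - expPartial lam k) := by rw [mul_sub, hee]
    _ ≤ Real.exp (-lam) * (lam ^ k / (k ! : ℝ) * Real.exp lam) :=
        mul_le_mul_of_nonneg_left h hpos.le
    _ = lam ^ k / (k ! : ℝ) := by
        rw [mul_comm (lam ^ k / (k ! : ℝ)), ← mul_assoc, hee, one_mul]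

/-! ## The truncated Gamma integral -/

/-- `d/du Σ_{i≤k} (ru)^i/i! = r · Σ_{i<k} (ru)^i/i!`. [folklore] -/
theorem hasDerivAt_expPartial_mul (r : ℝ) (k : ℕ) (u : ℝ) :
    HasDerivAt (fun u => expPartial (r * u) (k + 1)) (r * expPartial (r * u) k) u := by
  unfold expPartial
  have h1 : HasDerivAt (fun u : ℝ => r * u) r u := by
    simpa using (hasDerivAt_id u).const_mul r
  have h : ∀ i ∈ range (k + 1), HasDerivAt (fun u : ℝ => (r * u) ^ i / (i ! : ℝ))
      ((i : ℝ) * (r * u) ^ (i - 1) * r / (i ! : ℝ)) u := by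
    intro i _
    exact (h1.fun_pow i).div_const _
  have hs := HasDerivAt.fun_sum h
  refine hs.congr_deriv ?_
  rw [sum_range_succ', Nat.cast_zero, zero_mul, zero_mul, zero_div, add_zero, mul_sum]
  refine sum_congr rfl fun i _ => ?_
  have hne : ((i + 1 : ℕ) : ℝ) ≠ 0 := by exact_mod_cast Nat.succ_ne_zero i
  rw [Nat.add_sub_cancel, Nat.factorial_succ, Nat.cast_mul, mul_assoc (((i + 1 : ℕ) : ℝ)),
    mul_div_mul_left _ _ hne]
  ring

/-- The closed-form antiderivative of `uᵏ e^{-ru}`: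
`d/du [-(k!/r^{k+1}) e^{-ru} Σ_{i≤k} (ru)^i/i!] = uᵏ e^{-ru}` (`r ≠ 0`). [folklore] -/
theorem hasDerivAt_truncGammaPrim (k : ℕ) {r : ℝ} (hr : r ≠ 0) (u : ℝ) :
    HasDerivAt (fun u => -((k ! : ℝ) / r ^ (k + 1)) * (Real.exp (-(r * u)) * expPartial (r * u) (k + 1)))
      (u ^ k * Real.exp (-(r * u))) u := by
  have hE : HasDerivAt (fun u : ℝ => Real.exp (-(r * u))) (Real.exp (-(r * u)) * (-r)) u := by
    have h1 : HasDerivAt (fun u : ℝ => -(r * u)) (-r) u := by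
      have := (hasDerivAt_id u).const_mul (-r)
      simpa [neg_mul] using this
    exact h1.exp
  have hS := hasDerivAt_expPartial_mul r k u
  have hprod := (hE.fun_mul hS).const_mul (-((k ! : ℝ) / r ^ (k + 1)))
  refine hprod.congr_deriv ?_
  rw [expPartial_succ, mul_pow]
  field_simp
  ring

/-- **Truncated Gamma integral at integer parameter.**  For `r > 0`, `T ≥ 0`:
`∫_{0<u≤T} uᵏ e^{-ru} du = k!/r^{k+1} · (1 - e^{-rT} Σ_{i≤k} (rT)^i/i!) = k!/r^{k+1} · ℙ[Poisson(rT) ≥ k+1]`.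
[folklore] -/
theorem integral_pow_mul_exp_neg_mul_Ioc (k : ℕ) {r : ℝ} (hr : 0 < r) {T : ℝ} (hT : 0 ≤ T) :
    ∫ u in Ioc 0 T, u ^ k * Real.exp (-(r * u))
      = (k ! : ℝ) / r ^ (k + 1) * poissonTail (r * T) (k + 1) := by
  rw [← intervalIntegral.integral_of_le hT]
  have hint : IntervalIntegrable (fun u : ℝ => u ^ k * Real.exp (-(r * u))) volume 0 T :=
    ((continuous_pow k).mul (Real.continuous_exp.comp
      ((continuous_const.mul continuous_id).neg))).intervalIntegrable _ _
  rw [intervalIntegral.integral_eq_sub_of_hasDerivAt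
    (fun u _ => hasDerivAt_truncGammaPrim k hr.ne' u) hint]
  rw [mul_zero, neg_zero, Real.exp_zero, one_mul, expPartial_zero_left_succ, poissonTail]
  ring

/-! ## The Poissonised terms and their truncated integrals -/

section Terms

variable (d) (n : ℕ) (x : Fin d → ℤ)

/-- The `m`-th term of the Poissonised series:
`F_m(u) = d^{n+1}/n! · uⁿ · e^{-du} · p_m(x;d) (du)^m/m!`. [folklore] -/
def uTerm (m : ℕ) (u : ℝ) : ℝ :=
  (d : ℝ) ^ (n + 1) / (n ! : ℝ) * u ^ n * (Real.exp (-(d * u)) * (srwLaw d m x * (d * u) ^ m / (m ! : ℝ)))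

/-- The coefficient `K_m = d^{n+1}/n! · p_m d^m/m!` with `F_m(u) = K_m · u^{m+n} e^{-du}`. [folklore] -/
def uCoeff (m : ℕ) : ℝ :=
  (d : ℝ) ^ (n + 1) / (n ! : ℝ) * (srwLaw d m x * (d : ℝ) ^ m / (m ! : ℝ))

variable {d n x}

/-- `F_m(u) = K_m · u^{m+n} e^{-du}`. [folklore] -/
theorem uTerm_eq (m : ℕ) (u : ℝ) :
    uTerm d n x m u = uCoeff d n x m * (u ^ (m + n) * Real.exp (-(d * u))) := by
  simp only [uTerm, uCoeff, mul_pow, pow_add]; ring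

/-- `0 ≤ K_m`. [folklore] -/
theorem uCoeff_nonneg (m : ℕ) : 0 ≤ uCoeff d n x m := by
  have := srwLaw_nonneg m x
  unfold uCoeff; positivity

/-- `0 ≤ F_m(u)` for `u ≥ 0`. [folklore] -/
theorem uTerm_nonneg (m : ℕ) {u : ℝ} (hu : 0 ≤ u) : 0 ≤ uTerm d n x m u := by
  rw [uTerm_eq]
  exact mul_nonneg (uCoeff_nonneg m) (mul_nonneg (pow_nonneg hu _) (Real.exp_pos _).le)

/-- Pointwise: `Σ_m F_m(u) = d^{n+1}/n! · uⁿ ∏_μ q_u(x_μ)` (`d ≥ 1`; `hasSum_srwLaw_poisson`). [folklore] -/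
theorem hasSum_uTerm (hd : 1 ≤ d) (u : ℝ) :
    HasSum (fun m => uTerm d n x m u)
      ((d : ℝ) ^ (n + 1) / (n ! : ℝ) * (u ^ n * ∏ μ : Fin d, srwHeatKernel u (x μ))) := by
  have hd' : (d : ℝ) ≠ 0 := by exact_mod_cast (by omega : d ≠ 0)
  have h := hasSum_srwLaw_poisson hd x (d * u)
  rw [mul_div_cancel_left₀ u hd'] at h
  have h2 := h.mul_left ((d : ℝ) ^ (n + 1) / (n ! : ℝ) * u ^ n)
  simp only [uTerm, mul_assoc] at h2 ⊢
  exact h2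

/-- `C(m+n,n) · p_m(x;d) = K_m · (m+n)!/d^{m+n+1}`. [folklore] -/
theorem uCoeff_mul_factorial_div (hd : 1 ≤ d) (m : ℕ) :
    uCoeff d n x m * (((m + n)! : ℝ) / (d : ℝ) ^ (m + n + 1))
      = (((m + n).choose n : ℕ) : ℝ) * srwLaw d m x := by
  have hd' : (d : ℝ) ≠ 0 := by exact_mod_cast (by omega : d ≠ 0)
  have hch : (((m + n).choose n : ℕ) : ℝ) * ((m ! : ℝ) * (n ! : ℝ)) = ((m + n)! : ℝ) := by
    rw [Nat.add_comm m n, Nat.choose_symm_add]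
    have h := Nat.add_choose_mul_factorial_mul_factorial n m
    rw [Nat.add_comm n m] at h ⊢
    exact_mod_cast (by rw [mul_comm (m !) (n !), ← mul_assoc]; exact h)
  unfold uCoeff
  rw [show (d : ℝ) ^ (m + n + 1) = (d : ℝ) ^ (n + 1) * (d : ℝ) ^ m by ring]
  field_simp
  rw [← hch]
  ring

/-- `F_m` is integrable on `(0,∞)` (`d ≥ 1`). [folklore] -/
theorem integrableOn_uTerm_Ioi (hd : 1 ≤ d) (m : ℕ) : IntegrableOn (uTerm d n x m) (Ioi 0) := by
  have hd0 : (0 : ℝ) < d := by exact_mod_cast (by omega : 0 < d)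
  have h : IntegrableOn (fun u : ℝ => uCoeff d n x m * (u ^ (m + n) * Real.exp (-(d * u)))) (Ioi 0) :=
    (integrableOn_pow_mul_exp_neg_mul_Ioi (m + n) hd0).const_mul (uCoeff d n x m)
  exact h.congr_fun (fun u _ => (uTerm_eq m u).symm) measurableSet_Ioi

/-- `∫_{u>0} F_m = C(m+n,n) p_m(x;d)`. [folklore] -/
theorem integral_uTerm_Ioi (hd : 1 ≤ d) (m : ℕ) :
    ∫ u in Ioi (0 : ℝ), uTerm d n x m u = (((m + n).choose n : ℕ) : ℝ) * srwLaw d m x := by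
  have hd0 : (0 : ℝ) < d := by exact_mod_cast (by omega : 0 < d)
  simp_rw [uTerm_eq]
  rw [integral_const_mul, integral_pow_mul_exp_neg_mul_Ioi (m + n) hd0,
    uCoeff_mul_factorial_div hd]

/-- `∫_{0<u≤T} F_m = C(m+n,n) p_m(x;d) · ℙ[Poisson(dT) ≥ m+n+1]`. [folklore] -/
theorem integral_uTerm_Ioc (hd : 1 ≤ d) (m : ℕ) {T : ℝ} (hT : 0 ≤ T) :
    ∫ u in Ioc (0 : ℝ) T, uTerm d n x m u
      = (((m + n).choose n : ℕ) : ℝ) * srwLaw d m x * poissonTail (d * T) (m + n + 1) := by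
  have hd0 : (0 : ℝ) < d := by exact_mod_cast (by omega : 0 < d)
  simp_rw [uTerm_eq]
  rw [integral_const_mul, integral_pow_mul_exp_neg_mul_Ioc (m + n) hd0 hT, ← mul_assoc,
    uCoeff_mul_factorial_div hd]

/-- `∫_{u>T} F_m = C(m+n,n) p_m(x;d) · (1 - ℙ[Poisson(dT) ≥ m+n+1])`. [folklore] -/
theorem integral_uTerm_Ioi_of_nonneg (hd : 1 ≤ d) (m : ℕ) {T : ℝ} (hT : 0 ≤ T) :
    ∫ u in Ioi T, uTerm d n x m u
      = (((m + n).choose n : ℕ) : ℝ) * srwLaw d m x * (1 - poissonTail (d * T) (m + n + 1)) := by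
  have hI := integrableOn_uTerm_Ioi (n := n) (x := x) hd m
  have hsplit := setIntegral_union (μ := volume) (f := uTerm d n x m)
    (Set.Ioc_disjoint_Ioi_same (a := (0 : ℝ)) (b := T)) measurableSet_Ioi
    (hI.mono_set Ioc_subset_Ioi_self) (hI.mono_set (Ioi_subset_Ioi hT))
  rw [Ioc_union_Ioi_eq_Ioi hT, integral_uTerm_Ioi hd, integral_uTerm_Ioc hd m hT] at hsplit
  linarith

end Terms

/-! ## The `[0,T]` block and the `[T,∞)` block as series; the split -/

/-- Term-wise integration of the Poissonised series over a measurable `s ⊆ (0,∞)`. [folklore] -/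
theorem hasSum_integral_uTerm (n : ℕ) (hd : 2 * n + 3 ≤ d) (x : Fin d → ℤ) {s : Set ℝ}
    (hs : MeasurableSet s) (hsub : s ⊆ Ioi 0) :
    HasSum (fun m => ∫ u in s, uTerm d n x m u)
      ((d : ℝ) ^ (n + 1) / (n ! : ℝ) * ∫ u in s, u ^ n * ∏ μ : Fin d, srwHeatKernel u (x μ)) := by
  have hd1 : 1 ≤ d := by omega
  -- integrability on `s` and domination of the norms by the full integrals `C(m+n,n) p_m`
  have hint : ∀ m, IntegrableOn (uTerm d n x m) s :=
    fun m => (integrableOn_uTerm_Ioi hd1 m).mono_set hsub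
  have hle : ∀ m, ∫ u in s, ‖uTerm d n x m u‖ ≤ (((m + n).choose n : ℕ) : ℝ) * srwLaw d m x := by
    intro m
    have h1 : ∫ u in s, ‖uTerm d n x m u‖ = ∫ u in s, uTerm d n x m u :=
      setIntegral_congr_fun hs fun u hu =>
        Real.norm_of_nonneg (uTerm_nonneg m (le_of_lt (hsub hu)))
    rw [h1, ← integral_uTerm_Ioi hd1 m]
    exact setIntegral_mono_set (integrableOn_uTerm_Ioi hd1 m)
      (ae_restrict_of_forall_mem measurableSet_Ioi fun u hu => uTerm_nonneg m (le_of_lt hu))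
      (Filter.Eventually.of_forall hsub)
  have hnn : ∀ m, 0 ≤ ∫ u in s, ‖uTerm d n x m u‖ := fun m => integral_nonneg fun u => norm_nonneg _
  have hB := hasSum_choose_mul_srwLaw_srwI n hd 0 x
  simp only [zero_add] at hB
  have hsum : Summable fun m => ∫ u in s, ‖uTerm d n x m u‖ :=
    Summable.of_nonneg_of_le hnn hle hB.summable
  have hswap := hasSum_integral_of_summable_integral_norm (μ := volume.restrict s) hint hsum
  -- the pointwise sum
  have hpt : (fun u => ∑' m, uTerm d n x m u)
      = fun u => (d : ℝ) ^ (n + 1) / (n ! : ℝ) * (u ^ n * ∏ μ : Fin d, srwHeatKernel u (x μ)) :=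
    funext fun u => (hasSum_uTerm hd1 u).tsum_eq
  rw [hpt, integral_const_mul] at hswap
  exact hswap

/-- **The `[0,T]` block is a Poisson-tail series.**  For `d ≥ 2n+3`, `T ≥ 0`, `x ∈ ℤᵈ`:
`Σ_m C(m+n,n) p_m(x;d) · ℙ[Poisson(dT) ≥ m+n+1] = d^{n+1}/n! · ∫_{0<u≤T} uⁿ ∏_μ q_u(x_μ) du`
— SEEDCERT-U L3: each term is a nonnegative real determined by `p_m(x;d)`, `e^{-dT}` and a
finite exponential sum. [cite: FitznerVanDerHofstad2016NoBLE, §5.1.1 (5.4)-(5.5) p. 1090] -/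
theorem hasSum_choose_mul_srwLaw_mul_poissonTail (n : ℕ) (hd : 2 * n + 3 ≤ d) (x : Fin d → ℤ)
    {T : ℝ} (hT : 0 ≤ T) :
    HasSum (fun m => (((m + n).choose n : ℕ) : ℝ) * srwLaw d m x * poissonTail (d * T) (m + n + 1))
      ((d : ℝ) ^ (n + 1) / (n ! : ℝ)
        * ∫ u in Ioc 0 T, u ^ n * ∏ μ : Fin d, srwHeatKernel u (x μ)) := by
  have h := hasSum_integral_uTerm n hd x measurableSet_Ioc (Ioc_subset_Ioi_self : Ioc (0 : ℝ) T ⊆ Ioi 0)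
  simp_rw [integral_uTerm_Ioc (by omega : 1 ≤ d) _ hT] at h
  exact h

/-- **The `[T,∞)` block as a series**: for `d ≥ 2n+3`, `T ≥ 0`,
`Σ_m C(m+n,n) p_m(x;d) · (1 - ℙ[Poisson(dT) ≥ m+n+1]) = d^{n+1}/n! · ∫_{u>T} uⁿ ∏_μ q_u(x_μ) du`.
[cite: FitznerVanDerHofstad2016NoBLE, §5.1.1 (5.4)-(5.5) p. 1090] -/
theorem hasSum_choose_mul_srwLaw_mul_one_sub_poissonTail (n : ℕ) (hd : 2 * n + 3 ≤ d)
    (x : Fin d → ℤ) {T : ℝ} (hT : 0 ≤ T) :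
    HasSum (fun m => (((m + n).choose n : ℕ) : ℝ) * srwLaw d m x
        * (1 - poissonTail (d * T) (m + n + 1)))
      ((d : ℝ) ^ (n + 1) / (n ! : ℝ)
        * ∫ u in Ioi T, u ^ n * ∏ μ : Fin d, srwHeatKernel u (x μ)) := by
  have h := hasSum_integral_uTerm n hd x measurableSet_Ioi (Ioi_subset_Ioi hT)
  simp_rw [integral_uTerm_Ioi_of_nonneg (by omega : 1 ≤ d) _ hT] at h
  exact h

/-- **The split of the `u`-representation at a cut-off `T ≥ 0`** (`d ≥ 2n+3`):
`srwI d (n+1) 0 x = d^{n+1}/n! · ∫_{0<u≤T} uⁿ∏_μ q_u(x_μ) du + d^{n+1}/n! · ∫_{u>T} uⁿ∏_μ q_u(x_μ) du`.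
[cite: FitznerVanDerHofstad2016NoBLE, §5.1.1 (5.4)-(5.5) p. 1090] -/
theorem srwI_succ_zero_eq_integral_Ioc_add_integral_Ioi (n : ℕ) (hd : 2 * n + 3 ≤ d)
    (x : Fin d → ℤ) {T : ℝ} (hT : 0 ≤ T) :
    srwI d (n + 1) 0 x
      = (d : ℝ) ^ (n + 1) / (n ! : ℝ) * (∫ u in Ioc 0 T, u ^ n * ∏ μ : Fin d, srwHeatKernel u (x μ))
        + (d : ℝ) ^ (n + 1) / (n ! : ℝ) * ∫ u in Ioi T, u ^ n * ∏ μ : Fin d, srwHeatKernel u (x μ) := by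
  have hadd := (hasSum_choose_mul_srwLaw_mul_poissonTail n hd x hT).add
    (hasSum_choose_mul_srwLaw_mul_one_sub_poissonTail n hd x hT)
  have hser := hasSum_choose_mul_srwLaw_srwI n hd 0 x
  simp only [zero_add] at hser
  have heq : (fun m => (((m + n).choose n : ℕ) : ℝ) * srwLaw d m x * poissonTail (d * T) (m + n + 1)
      + (((m + n).choose n : ℕ) : ℝ) * srwLaw d m x * (1 - poissonTail (d * T) (m + n + 1)))
      = fun m => (((m + n).choose n : ℕ) : ℝ) * srwLaw d m x := by
    funext m; ring
  rw [heq] at hadd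
  exact hser.unique hadd

/-- Every partial sum of the Poisson-tail series is a LOWER bound of the `[0,T]` block
(`d ≥ 2n+3`, `T ≥ 0`). [cite: FitznerVanDerHofstad2016NoBLE, §5.1.1 (5.4)-(5.5) p. 1090] -/
theorem sum_choose_mul_srwLaw_mul_poissonTail_le (n : ℕ) (hd : 2 * n + 3 ≤ d) (x : Fin d → ℤ)
    {T : ℝ} (hT : 0 ≤ T) (M : ℕ) :
    ∑ m ∈ range M, (((m + n).choose n : ℕ) : ℝ) * srwLaw d m x * poissonTail (d * T) (m + n + 1)
      ≤ (d : ℝ) ^ (n + 1) / (n ! : ℝ)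
        * ∫ u in Ioc 0 T, u ^ n * ∏ μ : Fin d, srwHeatKernel u (x μ) := by
  have hlam0 : (0 : ℝ) ≤ d * T := mul_nonneg (Nat.cast_nonneg d) hT
  exact sum_le_hasSum (range M)
    (fun m _ => mul_nonneg (mul_nonneg (Nat.cast_nonneg _) (srwLaw_nonneg m x))
      (poissonTail_nonneg hlam0 _))
    (hasSum_choose_mul_srwLaw_mul_poissonTail n hd x hT)

/-- … and the `[0,T]` block exceeds the `M`-th partial sum by at most the `M`-tail of the plain
series `Σ_m C(m+n,n) p_m = srwI d (n+1) 0 x` (`ℙ[Poisson ≥ ·] ≤ 1`): for `d ≥ 2n+3`, `T ≥ 0`,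
`d^{n+1}/n! ∫_{0<u≤T} uⁿ∏q_u ≤ Σ_{m<M} C(m+n,n) p_m ℙ[Poisson(dT) ≥ m+n+1] + (srwI d (n+1) 0 x - Σ_{m<M} C(m+n,n) p_m)`.
[cite: FitznerVanDerHofstad2016NoBLE, §5.1.1 (5.4)-(5.5) p. 1090] -/
theorem integral_Ioc_le_sum_add_tail (n : ℕ) (hd : 2 * n + 3 ≤ d) (x : Fin d → ℤ)
    {T : ℝ} (hT : 0 ≤ T) (M : ℕ) :
    (d : ℝ) ^ (n + 1) / (n ! : ℝ) * ∫ u in Ioc 0 T, u ^ n * ∏ μ : Fin d, srwHeatKernel u (x μ)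
      ≤ ∑ m ∈ range M, (((m + n).choose n : ℕ) : ℝ) * srwLaw d m x * poissonTail (d * T) (m + n + 1)
        + (srwI d (n + 1) 0 x - ∑ m ∈ range M, (((m + n).choose n : ℕ) : ℝ) * srwLaw d m x) := by
  have hlam0 : (0 : ℝ) ≤ d * T := mul_nonneg (Nat.cast_nonneg d) hT
  set a : ℕ → ℝ := fun m =>
    (((m + n).choose n : ℕ) : ℝ) * srwLaw d m x * poissonTail (d * T) (m + n + 1) with ha
  set b : ℕ → ℝ := fun m => (((m + n).choose n : ℕ) : ℝ) * srwLaw d m x with hb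
  have hA := hasSum_choose_mul_srwLaw_mul_poissonTail n hd x hT
  have hB := hasSum_choose_mul_srwLaw_srwI n hd 0 x
  simp only [zero_add] at hB
  -- tails after `M`
  have hA' := (hasSum_nat_add_iff' M).mpr hA
  have hB' := (hasSum_nat_add_iff' M).mpr hB
  have hle : ∀ m, a (m + M) ≤ b (m + M) := by
    intro m
    have hb0 : 0 ≤ b (m + M) := mul_nonneg (Nat.cast_nonneg _) (srwLaw_nonneg _ x)
    calc a (m + M) = b (m + M) * poissonTail (d * T) (m + M + n + 1) := rfl
      _ ≤ b (m + M) * 1 := mul_le_mul_of_nonneg_left (poissonTail_le_one hlam0 _) hb0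
      _ = b (m + M) := mul_one _
  have htail := hasSum_le hle hA' hB'
  linarith

/-- The `[0,T]` block is bounded ABOVE by the `M`-th partial sum plus ANY bound `R` of the
explicit, `p`-free majorant `Σ_{m≥M} C(m+n,n) · ℙ[Poisson(dT) ≥ m+n+1]` of its `M`-tail
(`p_m ≤ 1`); with `poissonTail_le_pow_div_factorial` the majorant is dominated by an exponential
series tail, so the `[0,T]` block is two-sidedly bracketed by finitely many `p_m(x;d)`, `e^{-dT}`
and rational arithmetic (`d ≥ 2n+3`, `T ≥ 0`). [cite: FitznerVanDerHofstad2016NoBLE, §5.1.1 (5.4)-(5.5) p. 1090] -/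
theorem integral_Ioc_le_sum_add_of_hasSum (n : ℕ) (hd : 2 * n + 3 ≤ d) (x : Fin d → ℤ)
    {T : ℝ} (hT : 0 ≤ T) (M : ℕ) {R : ℝ}
    (hR : HasSum (fun m => (((m + M + n).choose n : ℕ) : ℝ) * poissonTail (d * T) (m + M + n + 1)) R) :
    (d : ℝ) ^ (n + 1) / (n ! : ℝ) * ∫ u in Ioc 0 T, u ^ n * ∏ μ : Fin d, srwHeatKernel u (x μ)
      ≤ ∑ m ∈ range M, (((m + n).choose n : ℕ) : ℝ) * srwLaw d m x * poissonTail (d * T) (m + n + 1)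
        + R := by
  have hd1 : 1 ≤ d := by omega
  have hlam0 : (0 : ℝ) ≤ d * T := mul_nonneg (Nat.cast_nonneg d) hT
  set a : ℕ → ℝ := fun m =>
    (((m + n).choose n : ℕ) : ℝ) * srwLaw d m x * poissonTail (d * T) (m + n + 1) with ha
  have hA := hasSum_choose_mul_srwLaw_mul_poissonTail n hd x hT
  have hA' := (hasSum_nat_add_iff' M).mpr hA
  have hle : ∀ m, a (m + M)
      ≤ (((m + M + n).choose n : ℕ) : ℝ) * poissonTail (d * T) (m + M + n + 1) := by
    intro m
    have hp1 : srwLaw d (m + M) x ≤ 1 := srwLaw_le_one hd1 _ x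
    have hp0 : 0 ≤ srwLaw d (m + M) x := srwLaw_nonneg _ x
    have hq0 : 0 ≤ poissonTail (d * T) (m + M + n + 1) := poissonTail_nonneg hlam0 _
    have hc0 : (0 : ℝ) ≤ (((m + M + n).choose n : ℕ) : ℝ) := Nat.cast_nonneg _
    calc a (m + M) = (((m + M + n).choose n : ℕ) : ℝ) * srwLaw d (m + M) x
          * poissonTail (d * T) (m + M + n + 1) := rfl
      _ ≤ (((m + M + n).choose n : ℕ) : ℝ) * 1 * poissonTail (d * T) (m + M + n + 1) := by
          gcongr
      _ = _ := by rw [mul_one]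
  have htail := hasSum_le hle hA' hR
  linarith

end Literature.Probability.FitznerVanDerHofstad2017
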